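import Summits.Parity.GeneralizedHardyLittlewood.Theorems.LiouvilleShiftedTablesSieveToMAvgBoxes
import Literature.NumberTheory.Sieve.BombieriFriedlanderIwaniecCombinatorics

/-!
# Sieve glue for `SieveToMAvg`, part 4: classification of the box-tuples

Support file for item stmt-Parity-14274 (route `LiouvilleShiftedTables`).  Pure real arithmetic
(Heath-Brown 1982 / Harman, *Prime-detecting sieves*, §3.2 style): let `g_i = log P_i` be the
logarithmic sizes of the `2j` boxes of a tuple (`j ≥ 1`), `L = log 2x`, and `0 < a`, `2a ≤ b`
thresholds with `3b L ≥ L + 2j ℓ₀` where `−ℓ₀ ≤ g_i` for all `i`.  Suppose the Möbius slots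
(`i < j`) have `g_i < bL`, and `(1 − c)L < ∑ g_i < L` with `a ≤ 1 − c`.  Then
(`Literature.NumberTheory.Sieve.BFI.exists_subsum_mem_Icc_or`):

* EITHER some partial sum `∑_{i∈S} g_i` lies in `[aL, bL]` (a Type-II grouping),
* OR the set `B` of slots with `g_i > bL` consists of one or two SMOOTH slots (`j ≤ i`) and the
  remaining slots total `< aL` (a "Type-I₂" grouping: `r` = the small slots, `s`, `n'` = the big ones).
-/

namespace Summit.Parity.GeneralizedHardyLittlewood.Theorems.SieveToMAvg

open Finset Real
open Literature.NumberTheory.Sieve.BFI (exists_subsum_mem_Icc_or)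

/-- **Classification of a box-tuple by the sizes of its boxes.** See the module docstring.
[cite: Heathbrown1982, Lemma 1 and §3] -/
theorem classify {j : ℕ} (g : Fin (2 * j) → ℝ) {L a b c ℓ₀ : ℝ} (hL : 0 < L)
    (ha : 0 < a) (hab : 2 * a ≤ b) (hac : a ≤ 1 - c) (hℓ₀ : 0 ≤ ℓ₀)
    (h3b : L + 2 * j * ℓ₀ ≤ 3 * b * L) (hlow : ∀ i, -ℓ₀ ≤ g i)
    (hμ : ∀ i : Fin (2 * j), (i : ℕ) < j → g i < b * L)
    (hlo : (1 - c) * L < ∑ i, g i) (hhi : ∑ i, g i < L) :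
    (∃ S : Finset (Fin (2 * j)), a * L ≤ ∑ i ∈ S, g i ∧ ∑ i ∈ S, g i ≤ b * L) ∨
    (∃ B : Finset (Fin (2 * j)), (B.card = 1 ∨ B.card = 2) ∧ (∀ i ∈ B, j ≤ (i : ℕ)) ∧
      (∀ i ∈ B, b * L < g i) ∧ (∀ i ∉ B, g i < a * L) ∧ ∑ i ∈ Bᶜ, g i < a * L) := by
  have haL : 0 < a * L := mul_pos ha hL
  have habL : 2 * (a * L) ≤ b * L := by nlinarith
  rcases exists_subsum_mem_Icc_or g haL habL with hII | ⟨hsm, hbig⟩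
  · exact Or.inl hII
  right
  classical
  set B : Finset (Fin (2 * j)) := Finset.univ.filter (fun i => b * L < g i) with hB
  have hmemB : ∀ i, i ∈ B ↔ b * L < g i := fun i => by simp [hB]
  have haLbL : a * L ≤ b * L := by nlinarith
  -- outside `B` every term is `< aL`
  have hout : ∀ i ∉ B, g i < a * L := by
    intro i hi
    rw [hmemB, not_lt] at hi
    by_contra h
    exact absurd (hbig i (not_lt.1 h)) (not_lt.2 hi)
  -- the complement of `B` is the set of small terms
  have hcompl : Bᶜ = Finset.univ.filter (fun i => g i < a * L) := by
    ext i
    simp only [Finset.mem_compl, Finset.mem_filter, Finset.mem_univ, true_and]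
    refine ⟨fun h => hout i h, fun h hB' => ?_⟩
    rw [hmemB] at hB'
    linarith
  have hsumc : ∑ i ∈ Bᶜ, g i < a * L := by rw [hcompl]; exact hsm
  -- smooth slots only
  have hsmooth : ∀ i ∈ B, j ≤ (i : ℕ) := by
    intro i hi
    rw [hmemB] at hi
    by_contra h
    exact absurd (hμ i (not_le.1 h)) (not_lt.2 hi.le)
  -- the sum over the complement is bounded below
  have hcl : -(2 * j * ℓ₀) ≤ ∑ i ∈ Bᶜ, g i := by
    calc -(2 * j * ℓ₀) = ∑ _i : Fin (2 * j), (-ℓ₀) := by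
          rw [Finset.sum_const, Finset.card_univ, Fintype.card_fin]; ring
      _ ≤ ∑ i ∈ Bᶜ, (-ℓ₀) := by
          rw [Finset.sum_const, Finset.sum_const, Finset.card_univ, Fintype.card_fin]
          simp only [smul_neg, neg_le_neg_iff]
          rw [nsmul_eq_mul, nsmul_eq_mul]
          refine mul_le_mul_of_nonneg_right ?_ hℓ₀
          have := Finset.card_le_univ Bᶜ
          rw [Fintype.card_fin] at this
          exact_mod_cast this
      _ ≤ ∑ i ∈ Bᶜ, g i := Finset.sum_le_sum fun i _ => hlow i
  have hsplit : ∑ i, g i = ∑ i ∈ B, g i + ∑ i ∈ Bᶜ, g i :=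
    (Finset.sum_add_sum_compl B g).symm
  -- `card B ≤ 2`
  have hcard2 : B.card ≤ 2 := by
    by_contra h
    have h3 : 3 ≤ B.card := by omega
    have hBsum : 3 * (b * L) ≤ ∑ i ∈ B, g i := by
      have hbL0 : 0 ≤ b * L := by nlinarith
      calc 3 * (b * L) ≤ B.card * (b * L) := by
            exact mul_le_mul_of_nonneg_right (by exact_mod_cast h3) hbL0
        _ = ∑ _i ∈ B, b * L := by rw [Finset.sum_const, nsmul_eq_mul]
        _ ≤ ∑ i ∈ B, g i := Finset.sum_le_sum fun i hi => ((hmemB i).1 hi).le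
    have : L ≤ ∑ i, g i := by rw [hsplit]; linarith
    linarith
  -- `card B ≥ 1`
  have hcard1 : 1 ≤ B.card := by
    by_contra h
    have h0 : B = ∅ := Finset.card_eq_zero.1 (by omega)
    have hB0 : ∑ i ∈ B, g i = 0 := by rw [h0, Finset.sum_empty]
    have : ∑ i, g i < a * L := by rw [hsplit, hB0, zero_add]; exact hsumc
    nlinarith
  exact ⟨B, by omega, hsmooth, fun i hi => (hmemB i).1 hi, hout, hsumc⟩

/-- **The non-Type-II tuples, with designated slots.**  In the second case of `classify` there is a
smooth slot `p` (the unboxed "`n'`" variable of the Type-I₂ estimate) with `g_p > bL` such that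
either all other slots total `< aL`, or there is a second smooth slot `σ ≠ p` with
`bL < g_σ ≤ g_p` and the slots outside `{p, σ}` total `< aL`. [cite: Heathbrown1982, §3] -/
theorem designate {j : ℕ} (g : Fin (2 * j) → ℝ) {L a b : ℝ}
    {B : Finset (Fin (2 * j))} (hcard : B.card = 1 ∨ B.card = 2) (hsmooth : ∀ i ∈ B, j ≤ (i : ℕ))
    (hbig : ∀ i ∈ B, b * L < g i) (hsumc : ∑ i ∈ Bᶜ, g i < a * L) :
    ∃ p : Fin (2 * j), j ≤ (p : ℕ) ∧ b * L < g p ∧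
      ((∑ i ∈ Finset.univ.erase p, g i < a * L) ∨
       (∃ σ : Fin (2 * j), σ ≠ p ∧ j ≤ (σ : ℕ) ∧ b * L < g σ ∧ g σ ≤ g p ∧
          ∑ i ∈ (Finset.univ.erase p).erase σ, g i < a * L)) := by
  classical
  rcases hcard with h1 | h2
  · obtain ⟨p, hp⟩ := Finset.card_eq_one.1 h1
    refine ⟨p, hsmooth p (by simp [hp]), hbig p (by simp [hp]), Or.inl ?_⟩
    have : Finset.univ.erase p = Bᶜ := by
      ext i; simp [hp]
    rw [this]; exact hsumc
  · obtain ⟨u, v, huv, hBuv⟩ := Finset.card_eq_two.1 h2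
    -- order the two big slots
    have key : ∀ p σ : Fin (2 * j), p ≠ σ → B = {p, σ} → g σ ≤ g p →
        ∃ p : Fin (2 * j), j ≤ (p : ℕ) ∧ b * L < g p ∧
          ((∑ i ∈ Finset.univ.erase p, g i < a * L) ∨
           (∃ σ : Fin (2 * j), σ ≠ p ∧ j ≤ (σ : ℕ) ∧ b * L < g σ ∧ g σ ≤ g p ∧
              ∑ i ∈ (Finset.univ.erase p).erase σ, g i < a * L)) := by
      intro p σ hne hB hle
      have hp : p ∈ B := by simp [hB]
      have hσ : σ ∈ B := by simp [hB]
      refine ⟨p, hsmooth p hp, hbig p hp, Or.inr ⟨σ, hne.symm, hsmooth σ hσ, hbig σ hσ, hle, ?_⟩⟩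
      have : (Finset.univ.erase p).erase σ = Bᶜ := by
        ext i
        simp only [Finset.mem_erase, Finset.mem_univ, and_true, Finset.mem_compl, hB,
          Finset.mem_insert, Finset.mem_singleton, not_or]
        tauto
      rw [this]; exact hsumc
    rcases le_total (g v) (g u) with h | h
    · exact key u v huv hBuv h
    · exact key v u (Ne.symm huv) (by rw [hBuv, Finset.pair_comm]) h

end Summit.Parity.GeneralizedHardyLittlewood.Theorems.SieveToMAvg
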